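import Summits.ResolutionOfSingularities.ResolutionOfSingularities.Theorems.RadicialJungCleanModelsCleanPermissibleDerivationObstruction
import HarnessLib

/-!
# Route `RadicialJung`, crux `CleanModels` (stmt-ResolutionOfSingularities-15917), line `Sketch` rev 35, stub 6 `stub_cleanProp44` (X44c):
# THE LEAD'S WITNESS `G = t₁`, `Y = V(t₂, t₁ - t₃²)`, KERNEL-CHECKED

Seat `leafhand-res-radicialjung-1` g0 (land-only hand).  Companion of `RadicialJungCleanModelsCleanPermissibleDerivationObstruction.lean`
(the derivation obstruction to `CleanPermissibleAt`).  The docstring of `RadicialJungCleanModelsCleanPermissibleSeq.lean` records, as the reason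
why Cossart–Piltant 2008 Prop. 4.4 does not transfer verbatim to X44c, the lead's witness «`G = t₁`, `Y = V(t₂, t₁ - t₃²)`: a regular curve
through a point where the line of `G` is clean-regular, which is NOT clean-permissible there».  This file makes the witness a kernel theorem, in
an ABSTRACT regular local ring so that no polynomial-ring plumbing is needed:

* `isRsopPart_leadWitness`, `leadWitness_isPrime_and_not_mem` — `(t₂, t₁ - t₃², t₃)` is a regular system of parameters; `I = (t₂, t₁ - t₃²)`
  is prime and `t₃ ∉ I`.
* `leadWitness_gen` — a minimal generator `x` of `I` with `x ∣ ∂₃ x` has `x ∤ ∂₂ x` (`p` odd): `∂₃ x ≡ -2βt₃ (mod I)` forces `β ∈ I`, so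
  `x ≡ α t₂ (mod 𝔪²)` with `α` a unit and `∂₂ x ≡ α`.
* `leadWitness_trans` — a parameter transversal to `I` has `x ∤ ∂₃ x` (`∂₃ x` is a unit).
* `not_cleanPermissibleAt_leadWitness` — **THE WITNESS**: `R` regular local of dimension `3` with regular system of parameters `(t₁, t₂, t₃)`,
  embedded by `f` in a field `F` of ODD characteristic `p`, residue field `p`-perfect (every element a `p`-th power mod `𝔪`), derivations
  `∂₂, ∂₃` of `R` with `∂₂ t₁ = 0`, `∂₂ t₂ = 1`, `∂₃ t₁ = ∂₃ t₂ = 0`, `∂₃ t₃ = 1` extending along `f` to derivations of `F` — all true for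
  `k[t₁, t₂, t₃]_{(t)} ⊆ k(t₁, t₂, t₃)`, `k` perfect — ⟹ `V(t₂, t₁ - t₃²)` is NOT clean-permissible for the line of `t₁`;
* `cleanRegAt_leadWitness` — … while the line of `t₁` IS clean-regular at `R`.
(For `p = 2` the curve IS clean-permissible: `t₁ - t₃² = t₁ + t₃²` lies on the line of `t₁` — memo `Sketch-memo-hand2-g12-stubs-5-7.md` §3.)

Honest framing: OURS, elementary; a TIGHTNESS witness for the design of X44c (clean-permissibility is a genuine restriction on curve centres).
Nothing here proves X44c, any case of `CleanModels`, or resolution of singularities in characteristic `p`.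
Setting only: [cite: CossartPiltant2008, Prop. 4.4] [cite: Piltant2013, §2 Axiom 4] [cite: Matsumura1987, Thm. 14.2, Thm. 14.3].
-/

noncomputable section

set_option linter.dupNamespace false -- mandated namespace of this single-conjunct summit

open IsLocalRing
open Literature.AlgebraicGeometry.Resolution

namespace Summit.ResolutionOfSingularities.ResolutionOfSingularities.Theorems.RadicialJung.CleanModels

universe u v

/-! ## The lead's witness `G = t₁`, `Y = V(t₂, t₁ - t₃²)` -/

section LeadWitness

variable {R : Type u} [CommRing R] [IsLocalRing R]

omit [IsLocalRing R] in
/-- Membership in the span of three elements, as an explicit combination. [folklore] -/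
theorem exists_eq_combination_of_mem_span_triple {a b c x : R} (hx : x ∈ Ideal.span ({a, b, c} : Set R)) :
    ∃ A B C : R, x = A * a + B * b + C * c := by
  rw [Ideal.mem_span_insert] at hx
  obtain ⟨A, y, hy, rfl⟩ := hx
  obtain ⟨B, C, rfl⟩ := Ideal.mem_span_pair.mp hy
  exact ⟨A, B, C, by ring⟩

/-- The coordinates `(t₂, t₁ - t₃², t₃)` form a regular system of parameters when `(t₁, t₂, t₃)` do. [folklore] -/
theorem isRsopPart_leadWitness (hR : IsRegularLocalRing R) (hdim : ringKrullDim R = 3) {t₁ t₂ t₃ : R}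
    (ht : Ideal.span ({t₁, t₂, t₃} : Set R) = maximalIdeal R) : IsRsopPart ![t₂, t₁ - t₃ ^ 2, t₃] := by
  refine ⟨hR, 0, Fin.elim0, by rw [hdim]; norm_cast, ?_⟩
  have h0 : Set.range (Fin.elim0 : Fin 0 → R) = ∅ := Set.range_eq_empty _
  rw [h0, Set.union_empty, ← ht]
  have hr : Set.range ![t₂, t₁ - t₃ ^ 2, t₃] = {t₂, t₁ - t₃ ^ 2, t₃} := by
    ext x
    simp only [Set.mem_range, Set.mem_insert_iff, Set.mem_singleton_iff]
    constructor
    · rintro ⟨i, rfl⟩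
      fin_cases i <;> simp
    · rintro (rfl | rfl | rfl)
      exacts [⟨0, rfl⟩, ⟨1, rfl⟩, ⟨2, rfl⟩]
  rw [hr]
  apply le_antisymm
  · rw [Ideal.span_le, Set.insert_subset_iff, Set.insert_subset_iff, Set.singleton_subset_iff]
    refine ⟨Ideal.subset_span (by simp), ?_, Ideal.subset_span (by simp)⟩
    exact Ideal.sub_mem _ (Ideal.subset_span (by simp))
      (by rw [pow_two]; exact Ideal.mul_mem_left _ _ (Ideal.subset_span (by simp)))
  · rw [Ideal.span_le, Set.insert_subset_iff, Set.insert_subset_iff, Set.singleton_subset_iff]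
    refine ⟨?_, Ideal.subset_span (by simp), Ideal.subset_span (by simp)⟩
    have h : (t₁ - t₃ ^ 2) + t₃ * t₃ ∈ Ideal.span ({t₂, t₁ - t₃ ^ 2, t₃} : Set R) :=
      Ideal.add_mem _ (Ideal.subset_span (by simp)) (Ideal.mul_mem_left _ _ (Ideal.subset_span (by simp)))
    rw [SetLike.mem_coe]
    convert h using 1
    ring

/-- For the witness: `I = (t₂, t₁ - t₃²)` is prime and does not contain `t₃`. [cite: Matsumura1987, Thm. 14.3] -/
theorem leadWitness_isPrime_and_not_mem (hR : IsRegularLocalRing R) (hdim : ringKrullDim R = 3) {t₁ t₂ t₃ : R}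
    (ht : Ideal.span ({t₁, t₂, t₃} : Set R) = maximalIdeal R) :
    (Ideal.span ({t₂, t₁ - t₃ ^ 2} : Set R)).IsPrime ∧ t₃ ∉ Ideal.span ({t₂, t₁ - t₃ ^ 2} : Set R) := by
  have hz := isRsopPart_leadWitness hR hdim ht
  have himg : (![t₂, t₁ - t₃ ^ 2, t₃] : Fin 3 → R) '' ({0, 1} : Set (Fin 3)) = {t₂, t₁ - t₃ ^ 2} := by
    rw [Set.image_insert_eq, Set.image_singleton]
    rfl
  have hcomp : Set.range ((![t₂, t₁ - t₃ ^ 2, t₃] : Fin 3 → R) ∘ Fin.castLE (by norm_num : 2 ≤ 3)) = {t₂, t₁ - t₃ ^ 2} := by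
    ext x
    simp only [Set.mem_range, Function.comp_apply, Set.mem_insert_iff, Set.mem_singleton_iff]
    constructor
    · rintro ⟨i, rfl⟩
      fin_cases i
      · exact Or.inl rfl
      · exact Or.inr rfl
    · rintro (rfl | rfl)
      · exact ⟨0, rfl⟩
      · exact ⟨1, rfl⟩
  refine ⟨?_, ?_⟩
  · have h := (hz.comp (Fin.castLE (by norm_num : 2 ≤ 3)) (Fin.castLE_injective _)).isPrime_span_range
    rwa [hcomp] at h
  · have h := hz.not_mem_span_image (S := ({0, 1} : Set (Fin 3))) (i := 2) (by decide)
    rwa [himg] at h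

/-- Witness, step (i): a minimal generator `x` of `I = (t₂, t₁ - t₃²)` with `x ∣ ∂₃ x` has `x ∤ ∂₂ x` (`p` odd).  Writing
`x = α t₂ + β (t₁ - t₃²)`: `∂₃ x ≡ -2 β t₃ (mod I)`, so `x ∣ ∂₃ x` forces `β ∈ I`, hence `α` is a unit (`x ∉ 𝔪²`) and `∂₂ x ≡ α` is a unit.
[cite: Matsumura1987, Thm. 14.2] -/
theorem leadWitness_gen (hR : IsRegularLocalRing R) (hdim : ringKrullDim R = 3) {p : ℕ} [Fact p.Prime] [CharP R p] (hp2 : p ≠ 2)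
    {t₁ t₂ t₃ : R} (ht : Ideal.span ({t₁, t₂, t₃} : Set R) = maximalIdeal R) (d₂ d₃ : Derivation ℤ R R)
    (h22 : d₂ t₂ = 1) (h31 : d₃ t₁ = 0) (h32 : d₃ t₂ = 0) (h33 : d₃ t₃ = 1) {x : R}
    (hxI : x ∈ Ideal.span ({t₂, t₁ - t₃ ^ 2} : Set R)) (hx2 : x ∉ maximalIdeal R ^ 2) (hdvd₃ : x ∣ d₃ x) : ¬ x ∣ d₂ x := by
  set s : R := t₁ - t₃ ^ 2 with hs
  set I : Ideal R := Ideal.span ({t₂, s} : Set R) with hI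
  obtain ⟨hIprime, ht₃I⟩ := leadWitness_isPrime_and_not_mem hR hdim ht
  have hIm : I ≤ maximalIdeal R := IsLocalRing.le_maximalIdeal hIprime.ne_top
  have ht₂I : t₂ ∈ I := Ideal.subset_span (by simp)
  have hsI : s ∈ I := Ideal.subset_span (by simp)
  have ht₂m : t₂ ∈ maximalIdeal R := hIm ht₂I
  have hsm : s ∈ maximalIdeal R := hIm hsI
  have ht₃m : t₃ ∈ maximalIdeal R := ht ▸ Ideal.subset_span (by simp)
  obtain ⟨α, β, hx⟩ := Ideal.mem_span_pair.mp hxI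
  -- `d₃ s = -2 t₃`, `d₃ x ≡ -2 β t₃ (mod I)`
  have hd₃s : d₃ s = -(2 * t₃) := by
    rw [hs, map_sub, Derivation.leibniz_pow, h31, h33]
    simp only [smul_eq_mul, nsmul_eq_mul, Nat.cast_ofNat, mul_one]
    ring
  have hcalc : d₃ x = t₂ * d₃ α + s * d₃ β - 2 * (β * t₃) := by
    rw [← hx, map_add, Derivation.leibniz, Derivation.leibniz, h32, hd₃s]
    simp only [smul_eq_mul]
    ring
  -- `x ∣ d₃ x` puts `2 β t₃` in `I`
  have h2βt : (2 : R) * (β * t₃) ∈ I := by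
    have hdx : d₃ x ∈ I := by
      obtain ⟨r, hr⟩ := hdvd₃
      rw [hr]
      exact Ideal.mul_mem_right _ _ hxI
    have : (2 : R) * (β * t₃) = t₂ * d₃ α + s * d₃ β - d₃ x := by rw [hcalc]; ring
    rw [this]
    exact Ideal.sub_mem _ (Ideal.add_mem _ (Ideal.mul_mem_right _ _ ht₂I) (Ideal.mul_mem_right _ _ hsI)) hdx
  have h2 : IsUnit (2 : R) := by
    have h := isUnit_natCast_of_not_dvd p (S := R)
      (fun h => hp2 ((Nat.prime_dvd_prime_iff_eq Fact.out Nat.prime_two).mp h))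
    simpa using h
  have hβt : β * t₃ ∈ I := (Ideal.unit_mul_mem_iff_mem I h2).mp h2βt
  have hβ : β ∈ I := ((hIprime.mem_or_mem hβt).resolve_right ht₃I)
  -- hence `α` is a unit
  have hα : IsUnit α := by
    by_contra hα
    have hαm : α ∈ maximalIdeal R := (IsLocalRing.mem_maximalIdeal α).mpr hα
    apply hx2
    rw [← hx, pow_two]
    exact Ideal.add_mem _ (Ideal.mul_mem_mul hαm ht₂m) (Ideal.mul_mem_mul (hIm hβ) hsm)
  -- and `d₂ x ≡ α (mod 𝔪)` is a unit, which `x ∈ 𝔪` cannot divide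
  have hd₂x : d₂ x = α + (t₂ * d₂ α + s * d₂ β + β * d₂ s) := by
    rw [← hx, map_add, Derivation.leibniz, Derivation.leibniz, h22]
    simp only [smul_eq_mul]
    ring
  have hrest : t₂ * d₂ α + s * d₂ β + β * d₂ s ∈ maximalIdeal R :=
    Ideal.add_mem _ (Ideal.add_mem _ (Ideal.mul_mem_right _ _ ht₂m) (Ideal.mul_mem_right _ _ hsm))
      (Ideal.mul_mem_right _ _ (hIm hβ))
  have hunit : IsUnit (d₂ x) := by
    by_contra hnu
    have hm : d₂ x ∈ maximalIdeal R := (IsLocalRing.mem_maximalIdeal _).mpr hnu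
    have : α ∈ maximalIdeal R := by
      have h := Ideal.sub_mem _ hm hrest
      rwa [hd₂x, add_sub_cancel_right] at h
    exact (IsLocalRing.mem_maximalIdeal α).mp this hα
  intro hdvd₂
  exact (IsLocalRing.mem_maximalIdeal x).mp (hIm hxI) (isUnit_of_dvd_unit hdvd₂ hunit)

/-- Witness, step (ii): a parameter `x` transversal to `I = (t₂, t₁ - t₃²)` (`x ∈ 𝔪 ∖ (I + 𝔪²)`) has `x ∤ ∂₃ x`: writing
`x = A t₁ + B t₂ + Γ t₃`, transversality forces `Γ` to be a unit (`t₁, t₂ ∈ I + 𝔪²`), and `∂₃ x ≡ Γ (mod 𝔪)`.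
[cite: Matsumura1987, Thm. 14.2] -/
theorem leadWitness_trans {t₁ t₂ t₃ : R} (ht : Ideal.span ({t₁, t₂, t₃} : Set R) = maximalIdeal R) (d₃ : Derivation ℤ R R)
    (h31 : d₃ t₁ = 0) (h32 : d₃ t₂ = 0) (h33 : d₃ t₃ = 1) {x : R} (hxm : x ∈ maximalIdeal R)
    (hx2 : x ∉ Ideal.span ({t₂, t₁ - t₃ ^ 2} : Set R) ⊔ maximalIdeal R ^ 2) : ¬ x ∣ d₃ x := by
  set I : Ideal R := Ideal.span ({t₂, t₁ - t₃ ^ 2} : Set R) with hI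
  have ht₁m : t₁ ∈ maximalIdeal R := ht ▸ Ideal.subset_span (by simp)
  have ht₂m : t₂ ∈ maximalIdeal R := ht ▸ Ideal.subset_span (by simp)
  have ht₃m : t₃ ∈ maximalIdeal R := ht ▸ Ideal.subset_span (by simp)
  obtain ⟨A, B, Γ, hx⟩ := exists_eq_combination_of_mem_span_triple (ht ▸ hxm : x ∈ Ideal.span ({t₁, t₂, t₃} : Set R))
  -- `t₁, t₂ ∈ I + 𝔪²`
  have ht₂J : t₂ ∈ I ⊔ maximalIdeal R ^ 2 := Ideal.mem_sup_left (Ideal.subset_span (by simp))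
  have ht₁J : t₁ ∈ I ⊔ maximalIdeal R ^ 2 := by
    have h : t₁ = (t₁ - t₃ ^ 2) + t₃ * t₃ := by ring
    rw [h]
    exact Ideal.add_mem _ (Ideal.mem_sup_left (Ideal.subset_span (by simp)))
      (Ideal.mem_sup_right (by rw [pow_two]; exact Ideal.mul_mem_mul ht₃m ht₃m))
  -- so `Γ` is a unit
  have hΓ : IsUnit Γ := by
    by_contra hΓ
    have hΓm : Γ ∈ maximalIdeal R := (IsLocalRing.mem_maximalIdeal Γ).mpr hΓ
    apply hx2
    rw [hx]
    refine Ideal.add_mem _ (Ideal.add_mem _ (Ideal.mul_mem_left _ _ ht₁J) (Ideal.mul_mem_left _ _ ht₂J))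
      (Ideal.mem_sup_right ?_)
    rw [pow_two]
    exact Ideal.mul_mem_mul hΓm ht₃m
  -- `d₃ x ≡ Γ (mod 𝔪)`
  have hd₃x : d₃ x = Γ + (t₁ * d₃ A + t₂ * d₃ B + t₃ * d₃ Γ) := by
    rw [hx, map_add, map_add, Derivation.leibniz, Derivation.leibniz, Derivation.leibniz, h31, h32, h33]
    simp only [smul_eq_mul]
    ring
  have hrest : t₁ * d₃ A + t₂ * d₃ B + t₃ * d₃ Γ ∈ maximalIdeal R :=
    Ideal.add_mem _ (Ideal.add_mem _ (Ideal.mul_mem_right _ _ ht₁m) (Ideal.mul_mem_right _ _ ht₂m))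
      (Ideal.mul_mem_right _ _ ht₃m)
  have hunit : IsUnit (d₃ x) := by
    by_contra hnu
    have hm : d₃ x ∈ maximalIdeal R := (IsLocalRing.mem_maximalIdeal _).mpr hnu
    have : Γ ∈ maximalIdeal R := by
      have h := Ideal.sub_mem _ hm hrest
      rwa [hd₃x, add_sub_cancel_right] at h
    exact (IsLocalRing.mem_maximalIdeal Γ).mp this hΓ
  intro hdvd
  exact (IsLocalRing.mem_maximalIdeal x).mp hxm (isUnit_of_dvd_unit hdvd hunit)

/-- **The lead's witness, kernel-checked.**  Let `R` be a regular local ring of dimension `3` with regular system of parameters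
`(t₁, t₂, t₃)`, embedded by `f` in a field `F` of odd characteristic `p`, with `p`-perfect residue field (every element is a `p`-th power
modulo `𝔪`), and carrying derivations `∂₂, ∂₃` with `∂₂ t₁ = 0`, `∂₂ t₂ = 1`, `∂₃ t₁ = ∂₃ t₂ = 0`, `∂₃ t₃ = 1` that extend along `f` to
derivations of `F` (all of this holds for `R = k[t₁, t₂, t₃]_{(t)} ⊆ F = k(t₁, t₂, t₃)`, `k` perfect, `∂ᵢ = ∂/∂tᵢ`).  Then the regular curve
`Y = V(t₂, t₁ - t₃²)` is NOT clean-permissible at `R` for the line of `G = t₁` — although that line is clean-regular at `R` (`t₁` is a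
regular parameter, loose clean form (1)).  So clean-permissibility is a genuine restriction on the curve centres of X44c.
[cite: Piltant2013, §2 Axiom 4] [cite: CossartPiltant2008, Prop. 4.4] -/
theorem not_cleanPermissibleAt_leadWitness {R : Type u} {F : Type u} [CommRing R] [IsLocalRing R] [Field F] {p : ℕ} [Fact p.Prime]
    [CharP F p] (hp2 : p ≠ 2) {f : R →+* F} (hf : Function.Injective f) (hR : IsRegularLocalRing R) (hdim : ringKrullDim R = 3)
    {t₁ t₂ t₃ : R} (ht : Ideal.span ({t₁, t₂, t₃} : Set R) = maximalIdeal R)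
    (hperf : ∀ u : R, ∃ c : R, u - c ^ p ∈ maximalIdeal R)
    (d₂ d₃ : Derivation ℤ R R) (D₂ D₃ : Derivation ℤ F F) (hD₂ : ∀ r, D₂ (f r) = f (d₂ r)) (hD₃ : ∀ r, D₃ (f r) = f (d₃ r))
    (h21 : d₂ t₁ = 0) (h22 : d₂ t₂ = 1) (h31 : d₃ t₁ = 0) (h32 : d₃ t₂ = 0) (h33 : d₃ t₃ = 1) :
    ¬ CleanPermissibleAt p f (f t₁) (Ideal.span ({t₂, t₁ - t₃ ^ 2} : Set R)) := by
  haveI : CharP R p := f.charP hf p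
  have hD₂G : D₂ (f t₁) = 0 := by rw [hD₂, h21, map_zero]
  have hD₃G : D₃ (f t₁) = 0 := by rw [hD₃, h31, map_zero]
  refine not_cleanPermissibleAt_of_derivations hf hperf (fun x hxI hx2 => ?_) (fun x hxm hx2 => ?_)
  · by_cases hdvd₃ : x ∣ d₃ x
    · exact ⟨D₂, d₂, hD₂, hD₂G, leadWitness_gen hR hdim hp2 ht d₂ d₃ h22 h31 h32 h33 hxI hx2 hdvd₃⟩
    · exact ⟨D₃, d₃, hD₃, hD₃G, hdvd₃⟩
  · exact ⟨D₃, d₃, hD₃, hD₃G, leadWitness_trans ht d₃ h31 h32 h33 hxm hx2⟩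

/-- … whereas the line of `G = t₁` IS clean-regular at `R` (`t₁` is a regular parameter: loose clean form (1) with one factor and exponent `1`),
so the witness lives inside the setting of X44c. [cite: Piltant2013, Def. 2.1] -/
theorem cleanRegAt_leadWitness {F : Type v} [Field F] {p : ℕ} [hp : Fact p.Prime] (f : R →+* F) (hR : IsRegularLocalRing R)
    (hdim : ringKrullDim R = 3) {t₁ t₂ t₃ : R} (ht : Ideal.span ({t₁, t₂, t₃} : Set R) = maximalIdeal R) :
    CleanRegAt p f (f t₁) := by
  classical
  have h1p : 1 < p := hp.out.one_lt
  refine ⟨hR, Pi.single (⟨1, h1p⟩ : Fin p) (1 : F), ⟨⟨1, h1p⟩, one_ne_zero, by simp⟩, ?_⟩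
  have hsum : (∑ j : Fin p, (Pi.single (⟨1, h1p⟩ : Fin p) (1 : F) : Fin p → F) j ^ p * f t₁ ^ (j : ℕ)) = f t₁ := by
    rw [Finset.sum_eq_single (⟨1, h1p⟩ : Fin p)]
    · simp
    · intro j _ hj
      rw [Pi.single_eq_of_ne hj, zero_pow hp.out.ne_zero, zero_mul]
    · intro h; exact absurd (Finset.mem_univ _) h
  rw [hsum]
  refine Or.inl ⟨3, 1, by norm_num, ![t₁, t₂, t₃], ![1], 1, isUnit_one, ?_, by rw [hdim]; norm_cast, Nat.one_pos, ?_, ?_⟩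
  · rw [← ht]
    congr 1
    ext x
    simp only [Set.mem_range, Set.mem_insert_iff, Set.mem_singleton_iff]
    constructor
    · rintro ⟨i, rfl⟩
      fin_cases i <;> simp
    · rintro (rfl | rfl | rfl)
      exacts [⟨0, rfl⟩, ⟨1, rfl⟩, ⟨2, rfl⟩]
  · intro i
    fin_cases i
    simpa using hp.out.one_lt.ne'
  · simp

end LeadWitness

end Summit.ResolutionOfSingularities.ResolutionOfSingularities.Theorems.RadicialJung.CleanModels

end
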